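import Literature.NumberTheory.GaloisRepresentations.ContinuousShapiroLiftRestrictHom
import HarnessLib

/-!
# Mackey's double-coset formula for CUP PRODUCTS of Shapiro lifts under restriction along `θ : D → G`,
# ALL orbits (`N ⊴ G` open normal of finite index) — companion of `ContinuousShapiroLiftRestrictHom.lean`

Generic continuous group cohomology (no number theory); namespace `Literature.NumberTheory.GaloisRepresentations`.
Definitions with bodies (the twisted comparison maps) and theorems; NO named fact, no `sorry`, no instance, no notation.

Let `θ : D →ₜ* G` be a continuous homomorphism, `N ⊴ G` an open NORMAL subgroup, `N_D := θ⁻¹(N) = N.comap θ ≤ D`,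
`ē : D ⧸ N_D → G ⧸ N` the injective `θ`-equivariant map of coset spaces (`quotientMapOfHom`), `X : TopRep R G`.
The group `D` acts on `G ⧸ N` through `θ`; its orbits are the sets `θ(D)·g·N = ē(D ⧸ N_D)·(gN)` (the double cosets
`θ(D) \ G / N`), every orbit has stabiliser `θ⁻¹(g N g⁻¹) = N_D` (normality), and a family `g : ι → G` is a system of
ORBIT REPRESENTATIVES exactly when `(i, y') ↦ ē(y')·(g_i N)` is a bijection `ι × (D ⧸ N_D) ≃ G ⧸ N`.
`ContinuousShapiroLiftRestrictHom.lean` treats ONE orbit (`θ(D)·N = G`); this file proves the general formula: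

* §1 `ContPairing.cupCocycle_mapPair_sum`, **`ContPairing.cupProduct_mapPair_sum`** — naturality of the cup product
  `H¹ × H¹ → H²` along a FAMILY of compatible pairs with one target: if `γ⟨x, y⟩₁ = Σ_{i ∈ s} ⟨α_i x, β_i y⟩₂` for module
  maps `α_i : X₁|_θ → X₂`, `β_i : Y₁|_θ → Y₂`, `γ : Z₁|_θ → Z₂` over `θ`, then
  `H²(θ, γ)(a ∪₁ b) = Σ_{i ∈ s} H¹(θ, α_i) a ∪₂ H¹(θ, β_i) b` (the tree's `cupProduct_mapPair` is `s = {pt}`);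
* §2 the TWISTED comparison morphisms **`Φ_c : Maps(G ⧸ N, X)|_θ ⟶ Maps(D ⧸ N_D, X|_θ)`, `(Φ_c F)(y') = F(ē(y')·c)`**
  for `c ∈ G ⧸ N` (`resCoindFinHomR`; `Φ_1` is the tree's `resCoindFinHom`) — the projections of Mackey's decomposition
  `θ^* Ind_N^G X ≅ ⊕_{orbits} Ind_{N_D}^D X|_θ` onto the summands (Brown III (5.6)(b); NSW (1.5.6));
* §3 **`H¹(θ, Φ_{γN})(Sh_N^G a) = Sh_{N_D}^D(θ_N^*(γ · a))`** (`map_resCoindFinHomR_shapiroLift`): `Φ_{γN} = Φ_1 ∘ R_{γN}`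
  with `R` the right translation, `H¹(R_{γN}) ∘ Sh_N^G = Sh_N^G ∘ (γ · )` (tree `shapiroLift_conjMap`, `γ · a = conjMap`)
  and the one-orbit theorem `map_resCoindFinHom_shapiroLift`;
* §4 the summed pairing splits along the orbits: `Σ_{y ∈ G/N} P(F y, F' y) = Σ_i Σ_{y' ∈ D/N_D} P((Φ_{c_i} F) y', (Φ_{c_i} F') y')`
  (`ContPairing.coindFin_toLin_sum_resCoindFinHomR`, reindexing by the orbit bijection);
* §5 **MACKEY'S FORMULA FOR CUP PRODUCTS OF SHAPIRO LIFTS** (`map_cupProduct_coindFin_shapiroLift_sum`): for orbit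
  representatives `g : ι → G`, `a ∈ H¹(N, X)`, `b ∈ H¹(N, Y)` and every continuous equivariant pairing `P : X × Y → Z`,
  `θ^*(Sh_N^G a ∪_{Σ P} Sh_N^G b) = Σ_i Sh_{N_D}^D(θ_N^*(g_i · a)) ∪_{Σ P|_θ} Sh_{N_D}^D(θ_N^*(g_i · b))` in `H²(D, Z|_θ)`,
  for ANY systems of representatives used in the Shapiro lifts; also with the bijection hypothesis phrased through local
  representatives `sD` (`…_sum'`, the binder shape of the RSL_g stub-plan's `MackeyOrbitCupFormula`).

Consumer: Tate–Poitou reciprocity along the layers `ℚ_n` of the cyclotomic `ℤ₂`-tower in the Shapiro model at the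
primes `ℓ ∈ S₀` that SPLIT in `ℚ_n` (crux RSL_g `ResidualSignedLambdaLowerCMAtTwo` of `Summits/BirchSwinnertonDyer`,
stub `stub_reciprocity`): `inv_ℓ` of the global class `Sh a ∪_Σ Sh b ∈ H²(Γ_ℚ, μ_{2^k})` is the SUM over the
`2^{min(n, n_ℓ)}` places of `ℚ_n` above `ℓ` of the local layer pairings of the CONJUGATES `g_i · a`, `g_i · b`
(`G = Γ_ℚ`, `N = Γ_{ℚ_n}`, `D = Γ_{ℚ_ℓ}`, `θ` the decomposition embedding). The one-orbit case (`ℓ = 2`, totally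
ramified) is what crux K3 `SignedKatoDivisibilityUpToAtTwo` used.

## References
* K. S. Brown, *Cohomology of Groups* (1982), III §5 (5.6)(b) (restriction of induced modules: the double coset
  formula), III (9.5), V §3 (cup products and transfer). [Brown1982]
* J. Neukirch, A. Schmidt, K. Wingberg, *Cohomology of Number Fields*, 2nd ed. (2008), I §5 Prop. (1.5.3) (cup products
  and compatible pairs), (1.5.6)–(1.5.7) (Mackey / double cosets), I §6 Prop. (1.6.4)–(1.6.5) (Shapiro's lemma and its
  functoriality). [NeukirchSchmidtWingberg2008]
* J.-P. Serre, *Local Fields* (1979), VII §5–§6. [SerreLocalFields1979]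
-/

noncomputable section

open CategoryTheory

open scoped Classical

universe u v w

namespace Literature.NumberTheory.GaloisRepresentations

open _root_.TopRep

variable {R : Type u} [CommRing R] [TopologicalSpace R]
variable {G : Type v} [Group G] [TopologicalSpace G]
variable {D : Type v} [Group D] [TopologicalSpace D]

/-! ## §1 Naturality of the cup product along a finite family of compatible pairs with one target -/

namespace ContPairing

section MapPairSum

variable {X₁ Y₁ Z₁ : TopRep.{v} R G} {X₂ Y₂ Z₂ : TopRep.{v} R D}

/-- Naturality of the cup-product cocycle along a FAMILY of compatible pairs `(θ; α_i, β_i)_{i ∈ s}` with common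
target map `γ`: if `γ⟨x, y⟩₁ = Σ_{i ∈ s} ⟨α_i x, β_i y⟩₂` then
`γ ∘ (f ∪₁ g) ∘ (θ × θ) = Σ_{i ∈ s} (α_i ∘ f ∘ θ) ∪₂ (β_i ∘ g ∘ θ)` ON COCYCLES.
[cite: NeukirchSchmidtWingberg2008, I §5 Prop. 1.5.3] -/
theorem cupCocycle_mapPair_sum [IsTopologicalGroup G] [IsTopologicalGroup D] {ι : Type w} (s : Finset ι)
    (P₁ : ContPairing X₁ Y₁ Z₁) (P₂ : ContPairing X₂ Y₂ Z₂) (θ : D →ₜ* G)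
    (α : ι → (TopRep.res (θ : D →* G) X₁ ⟶ X₂)) (β : ι → (TopRep.res (θ : D →* G) Y₁ ⟶ Y₂))
    (γ : TopRep.res (θ : D →* G) Z₁ ⟶ Z₂)
    (hc : ∀ x y, γ.hom (P₁.toLin x y) = ∑ i ∈ s, P₂.toLin ((α i).hom x) ((β i).hom y))
    (f : contOneCocycles X₁) (g : contOneCocycles Y₁) :
    contTwoCocycles.pullback θ γ (P₁.cupCocycle f g) =
      ∑ i ∈ s, P₂.cupCocycle (contOneCocycles.pullback θ (α i) f) (contOneCocycles.pullback θ (β i) g) := by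
  refine Subtype.ext (ContinuousMap.ext fun p => ?_)
  obtain ⟨σ, τ⟩ := p
  rw [Submodule.coe_sum, ContinuousMap.sum_apply, contTwoCocycles.pullback_apply, cupCocycle_apply, hc]
  refine Finset.sum_congr rfl fun i _ => ?_
  rw [cupCocycle_apply, contOneCocycles.pullback_apply, contOneCocycles.pullback_apply,
    contOneCocycles.pullback_apply, _root_.map_mul θ, map_sub]

/-- **Naturality of the cup product along a finite family of compatible pairs with one target**: if
`γ⟨x, y⟩₁ = Σ_{i ∈ s} ⟨α_i x, β_i y⟩₂` then `H²(θ, γ)(a ∪₁ b) = Σ_{i ∈ s} H¹(θ, α_i) a ∪₂ H¹(θ, β_i) b`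
(the case `s = {pt}` is the tree's `cupProduct_mapPair`). [cite: NeukirchSchmidtWingberg2008, I §5 Prop. 1.5.3] -/
theorem cupProduct_mapPair_sum [IsTopologicalGroup G] [IsTopologicalGroup D] [LocallyCompactSpace G]
    [LocallyCompactSpace D] {ι : Type w} (s : Finset ι)
    (P₁ : ContPairing X₁ Y₁ Z₁) (P₂ : ContPairing X₂ Y₂ Z₂) (θ : D →ₜ* G)
    (α : ι → (TopRep.res (θ : D →* G) X₁ ⟶ X₂)) (β : ι → (TopRep.res (θ : D →* G) Y₁ ⟶ Y₂))
    (γ : TopRep.res (θ : D →* G) Z₁ ⟶ Z₂)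
    (hc : ∀ x y, γ.hom (P₁.toLin x y) = ∑ i ∈ s, P₂.toLin ((α i).hom x) ((β i).hom y))
    (a : continuousCohomology 1 X₁) (b : continuousCohomology 1 Y₁) :
    ContinuousCohomology.map θ γ 2 (P₁.cupProduct a b) =
      ∑ i ∈ s, P₂.cupProduct (ContinuousCohomology.map θ (α i) 1 a) (ContinuousCohomology.map θ (β i) 1 b) := by
  obtain ⟨f, rfl⟩ := oneCocycleClass_surjective _ a
  obtain ⟨g, rfl⟩ := oneCocycleClass_surjective _ b
  rw [cupProduct_oneCocycleClass_eq_twoCocycleClass, map_twoCocycleClass,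
    cupCocycle_mapPair_sum s P₁ P₂ θ α β γ hc, ← twoCocycleClassₗ_apply, map_sum]
  refine Finset.sum_congr rfl fun i _ => ?_
  rw [twoCocycleClassₗ_apply, map_oneCocycleClass, map_oneCocycleClass,
    cupProduct_oneCocycleClass_eq_twoCocycleClass]

end MapPairSum

end ContPairing

/-! ## §2 The twisted comparison morphisms `Φ_c : Maps(G ⧸ N, X)|_θ ⟶ Maps(D ⧸ θ⁻¹N, X|_θ)`, `c ∈ G ⧸ N` -/

section PhiR

variable (X : TopRep.{v} R G) (N : Subgroup G) [N.Normal] (θ : D →ₜ* G)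

/-- **`Φ_c : Maps(G ⧸ N, X)|_θ ⟶ Maps(D ⧸ θ⁻¹N, X|_θ)`, `(Φ_c F)(y') = F(ē(y')·c)`** for `c ∈ G ⧸ N` (`N` normal, so
`G ⧸ N` is a group and `ē(y')·c` is a coset): a morphism of topological `D`-representations (`ē` is `θ`-equivariant
and the left action commutes with right multiplication) — the projection of Mackey's decomposition of `θ^* Ind_N^G X`
onto the summand of the double coset `θ(D)·c`. For `c = 1` this is the tree's `resCoindFinHom` (`resCoindFinHomR_one`).
[cite: Brown1982, III §5 (5.6)(b)] [cite: NeukirchSchmidtWingberg2008, I §5 (1.5.6)–(1.5.7)] -/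
def resCoindFinHomR (c : G ⧸ N) :
    TopRep.res (θ : D →* G) (coindFin X N) ⟶ coindFin (TopRep.res (θ : D →* G) X) (N.comap (θ : D →* G)) :=
  TopRep.ofHom
    { toContinuousLinearMap :=
        { toFun := fun F => fun y' => F (quotientMapOfHom N θ y' * c)
          map_add' := fun _ _ => rfl
          map_smul' := fun _ _ => rfl
          cont := continuous_pi fun y' => continuous_apply _ }
      isIntertwining' := fun d => by
        ext F y'
        change (coindFin X N).ρ (θ d) F (quotientMapOfHom N θ y' * c) =
          X.ρ (θ d) (F (quotientMapOfHom N θ (d⁻¹ • y') * c))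
        rw [coindFin_ρ_apply, quotientMapOfHom_smul, map_inv, smul_mul_quotient] }

/-- Values of `Φ_c`: `(Φ_c F)(y') = F(ē(y')·c)`. [cite: Brown1982, III §5 (5.6)(b)] -/
@[simp]
theorem resCoindFinHomR_apply (c : G ⧸ N) (F : coindFin X N) (y' : D ⧸ N.comap (θ : D →* G)) :
    (resCoindFinHomR X N θ c).hom F y' = F (quotientMapOfHom N θ y' * c) :=
  rfl

/-- `Φ_1 = Φ` (the tree's `resCoindFinHom`, the trivial double coset), on elements. [cite: Brown1982, III §5 (5.6)(b)] -/
theorem resCoindFinHomR_one (F : coindFin X N) :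
    (resCoindFinHomR X N θ 1).hom F = (resCoindFinHom X N θ).hom F :=
  funext fun y' => by rw [resCoindFinHomR_apply, mul_one, resCoindFinHom_apply]

/-- `Φ_c = Φ_1 ∘ R_c` on elements, `R_c` the right translation `(R_c F)(y) = F(y·c)` (`rTransHom`).
[cite: Brown1982, III §5 (5.6)(b)] [cite: SerreLocalFields1979, VII §5] -/
theorem resCoindFinHomR_eq_rTransHom (c : G ⧸ N) (F : coindFin X N) :
    (resCoindFinHomR X N θ c).hom F = (resCoindFinHom X N θ).hom ((rTransHom X N c).hom F) :=
  funext fun y' => by rw [resCoindFinHomR_apply, resCoindFinHom_apply, rTransHom_apply]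

end PhiR

/-! ## §3 Shapiro lifts under `H¹(θ, Φ_{γN})`: the double coset of `γ` -/

section Shapiro

variable (X : TopRep.{v} R G) (N : Subgroup G) [N.Normal] (θ : D →ₜ* G)

/-- **Shapiro lifts under `H¹(θ, Φ_{γN})` — the double coset `θ(D)·γ·N`.** For every class `a ∈ H¹(N, X)` and `γ ∈ G`:
`H¹(θ, Φ_{γN})(Sh_N^G a) = Sh_{θ⁻¹N}^D(θ_N^*(γ · a))`, where `γ · a = conjMap X N γ 1 a` is the conjugation action
(`[φ] ↦ [x ↦ γ • φ(γ⁻¹ x γ)]`), `θ_N^*` the restriction along `θ_N : θ⁻¹N → N` (`comapSubtypeHom`, identity on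
coefficients) and both Shapiro lifts are the tree's `shapiroLift` for arbitrary representatives with `s(1) = 1`.
Proof: `Φ_{γN} = Φ_1 ∘ R_{γN}`, `H¹(R_{γN})(Sh a) = Sh(γ · a)` (`shapiroLift_conjMap`) and the one-orbit theorem
`map_resCoindFinHom_shapiroLift`. [cite: Brown1982, III §5 (5.6)(b)] [cite: NeukirchSchmidtWingberg2008, I §6 Prop. (1.6.4)] -/
theorem map_resCoindFinHomR_shapiroLift [IsTopologicalGroup G] [IsTopologicalGroup D] (hN : IsOpen (N : Set G))
    {s : G ⧸ N → G} (hs : ∀ y : G ⧸ N, (s y : G ⧸ N) = y) (hs1 : s ((1 : G) : G ⧸ N) = 1)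
    {sD : D ⧸ N.comap (θ : D →* G) → D} (hsD : ∀ y, (sD y : D ⧸ N.comap (θ : D →* G)) = y)
    (hsD1 : sD ((1 : D) : D ⧸ N.comap (θ : D →* G)) = 1) (γ : G) (a : continuousCohomology 1 (subgroupRep X N)) :
    ContinuousCohomology.map θ (resCoindFinHomR X N θ (γ : G ⧸ N)) 1 (shapiroLift X N hN hs hs1 a) =
      shapiroLift (TopRep.res (θ : D →* G) X) (N.comap (θ : D →* G)) (isOpen_comap N θ hN) hsD hsD1
        (ContinuousCohomology.map (comapSubtypeHom N θ) (comapCoeffHom X N θ) 1 (conjMap X N γ 1 a)) := by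
  rw [← map_resCoindFinHom_shapiroLift X N θ hN hs hs1 hsD hsD1, shapiroLift_conjMap]
  obtain ⟨F, hF⟩ := oneCocycleClass_surjective _ (shapiroLift X N hN hs hs1 a)
  rw [← hF, cohomologyMap_oneCocycleClass, map_oneCocycleClass, map_oneCocycleClass]
  rfl

end Shapiro

/-! ## §4 The summed pairing splits along the orbits -/

namespace ContPairing

section Orbits

variable {X Y Z : TopRep.{v} R G} (P : ContPairing X Y Z) (N : Subgroup G) [N.Normal] (θ : D →ₜ* G)
  [Fintype (G ⧸ N)] [Fintype (D ⧸ N.comap (θ : D →* G))]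

/-- **The summed pairing splits along the `D`-orbits of `G ⧸ N`**: if `(i, y') ↦ ē(y')·c_i` is a bijection
`ι × (D ⧸ θ⁻¹N) ≃ G ⧸ N` (i.e. the `c_i` represent the double cosets `θ(D) \ G / N`), then
`Σ_{y ∈ G/N} P(F y, F' y) = Σ_i Σ_{y' ∈ D/θ⁻¹N} P((Φ_{c_i} F) y', (Φ_{c_i} F') y')` (reindexing).
[cite: NeukirchSchmidtWingberg2008, I §5 Prop. (1.5.3)(iv) and (1.5.6)] -/
theorem coindFin_toLin_sum_resCoindFinHomR {ι : Type w} [Fintype ι] (c : ι → G ⧸ N)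
    (hbij : Function.Bijective fun q : ι × (D ⧸ N.comap (θ : D →* G)) => quotientMapOfHom N θ q.2 * c q.1)
    (F : _root_.Literature.NumberTheory.GaloisRepresentations.coindFin X N)
    (F' : _root_.Literature.NumberTheory.GaloisRepresentations.coindFin Y N) :
    (P.coindFin N).toLin F F' =
      ∑ i, ((P.restrict θ).coindFin (N.comap (θ : D →* G))).toLin ((resCoindFinHomR X N θ (c i)).hom F)
        ((resCoindFinHomR Y N θ (c i)).hom F') := by
  rw [coindFin_toLin_apply, ← Equiv.sum_comp (Equiv.ofBijective _ hbij) (fun y => P.toLin (F y) (F' y)),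
    Fintype.sum_prod_type]
  refine Finset.sum_congr rfl fun i _ => ?_
  rw [coindFin_toLin_apply]
  exact Finset.sum_congr rfl fun y' _ => by
    rw [Equiv.ofBijective_apply, restrict_toLin, resCoindFinHomR_apply, resCoindFinHomR_apply]

end Orbits

/-! ## §5 Mackey's formula for cup products of Shapiro lifts -/

section Mackey

variable {X Y Z : TopRep.{v} R G} (P : ContPairing X Y Z) (N : Subgroup G) [N.Normal] (θ : D →ₜ* G)
  [Fintype (G ⧸ N)] [Fintype (D ⧸ N.comap (θ : D →* G))]

/-- **Mackey's double-coset formula for CUP PRODUCTS of Shapiro lifts, all orbits.** Let `N ⊴ G` be open normal of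
finite index, `θ : D →ₜ* G` continuous, `N_D := θ⁻¹N`, and `g : ι → G` ORBIT REPRESENTATIVES of the `D`-action on
`G ⧸ N` through `θ`: `(i, y') ↦ ē(y')·(g_i N)` is a bijection `ι × (D ⧸ N_D) ≃ G ⧸ N`. Then for `a ∈ H¹(N, X)`,
`b ∈ H¹(N, Y)` and every continuous equivariant pairing `P : X × Y → Z`, in `H²(D, Z|_θ)`:
`θ^*(Sh_N^G a ∪_{Σ P} Sh_N^G b) = Σ_i Sh_{N_D}^D(θ_N^*(g_i · a)) ∪_{Σ P|_θ} Sh_{N_D}^D(θ_N^*(g_i · b))`,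
`g · a = conjMap X N g 1 a`, for ANY systems of representatives in the Shapiro lifts (`s(1) = 1`, `sD(1) = 1`). The
one-orbit case (`ι = Unit`, `g = 1`, `θ(D)·N = G`) is the tree's `map_cupProduct_coindFin_shapiroLift` (`conjMap_one_one`).
Proof: §1 for the family `(Φ_{g_i N})_i` (compatibility = §4), then §3 termwise.
[cite: Brown1982, III §5 (5.6)(b)] [cite: NeukirchSchmidtWingberg2008, I §5 Prop. (1.5.3), (1.5.6)–(1.5.7) and I §6 Prop. (1.6.4)] -/
theorem map_cupProduct_coindFin_shapiroLift_sum [IsTopologicalGroup G] [IsTopologicalGroup D] [LocallyCompactSpace G]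
    [LocallyCompactSpace D] (hN : IsOpen (N : Set G)) {ι : Type w} [Fintype ι] (g : ι → G)
    (hbij : Function.Bijective fun q : ι × (D ⧸ N.comap (θ : D →* G)) => quotientMapOfHom N θ q.2 * (g q.1 : G ⧸ N))
    {s : G ⧸ N → G} (hs : ∀ y : G ⧸ N, (s y : G ⧸ N) = y) (hs1 : s ((1 : G) : G ⧸ N) = 1)
    {sD : D ⧸ N.comap (θ : D →* G) → D} (hsD : ∀ y, (sD y : D ⧸ N.comap (θ : D →* G)) = y)
    (hsD1 : sD ((1 : D) : D ⧸ N.comap (θ : D →* G)) = 1)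
    (a : continuousCohomology 1 (subgroupRep X N)) (b : continuousCohomology 1 (subgroupRep Y N)) :
    ContinuousCohomology.map θ (𝟙 (TopRep.res (θ : D →* G) Z)) 2
        ((P.coindFin N).cupProduct (shapiroLift X N hN hs hs1 a) (shapiroLift Y N hN hs hs1 b)) =
      ∑ i, ((P.restrict θ).coindFin (N.comap (θ : D →* G))).cupProduct
        (shapiroLift (TopRep.res (θ : D →* G) X) (N.comap (θ : D →* G)) (isOpen_comap N θ hN) hsD hsD1
          (ContinuousCohomology.map (comapSubtypeHom N θ) (comapCoeffHom X N θ) 1 (conjMap X N (g i) 1 a)))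
        (shapiroLift (TopRep.res (θ : D →* G) Y) (N.comap (θ : D →* G)) (isOpen_comap N θ hN) hsD hsD1
          (ContinuousCohomology.map (comapSubtypeHom N θ) (comapCoeffHom Y N θ) 1 (conjMap Y N (g i) 1 b))) := by
  rw [cupProduct_mapPair_sum Finset.univ (P.coindFin N) ((P.restrict θ).coindFin (N.comap (θ : D →* G))) θ
    (fun i => resCoindFinHomR X N θ (g i : G ⧸ N)) (fun i => resCoindFinHomR Y N θ (g i : G ⧸ N)) (𝟙 _)
    (fun F F' => coindFin_toLin_sum_resCoindFinHomR P N θ (fun i => (g i : G ⧸ N)) hbij F F') _ _]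
  exact Finset.sum_congr rfl fun i _ => by
    rw [map_resCoindFinHomR_shapiroLift X N θ hN hs hs1 hsD hsD1 (g i) a,
      map_resCoindFinHomR_shapiroLift Y N θ hN hs hs1 hsD hsD1 (g i) b]

/-- **Mackey's formula, bijection phrased through local representatives** (the binder shape of the RSL_g stub plan's
`MackeyOrbitCupFormula`): if `(i, y') ↦ θ(sD y')·g_i·N` is a bijection `ι × (D ⧸ θ⁻¹N) ≃ G ⧸ N` for a system of
representatives `sD` of `D ⧸ θ⁻¹N` with `sD(1) = 1`, then
`θ^*(Sh_N^G a ∪_{Σ P} Sh_N^G b) = Σ_i Sh_{θ⁻¹N}^D(θ_N^*(g_i · a)) ∪_{Σ P|_θ} Sh_{θ⁻¹N}^D(θ_N^*(g_i · b))`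
(`θ(sD y')·N = ē(y')`, so this is `map_cupProduct_coindFin_shapiroLift_sum`).
[cite: Brown1982, III §5 (5.6)(b)] [cite: NeukirchSchmidtWingberg2008, I §5 (1.5.6)–(1.5.7) and I §6 Prop. (1.6.4)] -/
theorem map_cupProduct_coindFin_shapiroLift_sum' [IsTopologicalGroup G] [IsTopologicalGroup D] [LocallyCompactSpace G]
    [LocallyCompactSpace D] (hN : IsOpen (N : Set G)) {ι : Type w} [Fintype ι] (g : ι → G)
    {s : G ⧸ N → G} (hs : ∀ y : G ⧸ N, (s y : G ⧸ N) = y) (hs1 : s ((1 : G) : G ⧸ N) = 1)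
    {sD : D ⧸ N.comap (θ : D →* G) → D} (hsD : ∀ y, (sD y : D ⧸ N.comap (θ : D →* G)) = y)
    (hsD1 : sD ((1 : D) : D ⧸ N.comap (θ : D →* G)) = 1)
    (hbij : Function.Bijective fun q : ι × (D ⧸ N.comap (θ : D →* G)) => ((θ (sD q.2) * g q.1 : G) : G ⧸ N))
    (a : continuousCohomology 1 (subgroupRep X N)) (b : continuousCohomology 1 (subgroupRep Y N)) :
    ContinuousCohomology.map θ (𝟙 (TopRep.res (θ : D →* G) Z)) 2
        ((P.coindFin N).cupProduct (shapiroLift X N hN hs hs1 a) (shapiroLift Y N hN hs hs1 b)) =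
      ∑ i, ((P.restrict θ).coindFin (N.comap (θ : D →* G))).cupProduct
        (shapiroLift (TopRep.res (θ : D →* G) X) (N.comap (θ : D →* G)) (isOpen_comap N θ hN) hsD hsD1
          (ContinuousCohomology.map (comapSubtypeHom N θ) (comapCoeffHom X N θ) 1 (conjMap X N (g i) 1 a)))
        (shapiroLift (TopRep.res (θ : D →* G) Y) (N.comap (θ : D →* G)) (isOpen_comap N θ hN) hsD hsD1
          (ContinuousCohomology.map (comapSubtypeHom N θ) (comapCoeffHom Y N θ) 1 (conjMap Y N (g i) 1 b))) := by
  refine map_cupProduct_coindFin_shapiroLift_sum P N θ hN g ?_ hs hs1 hsD hsD1 a b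
  have heq : (fun q : ι × (D ⧸ N.comap (θ : D →* G)) => quotientMapOfHom N θ q.2 * (g q.1 : G ⧸ N)) =
      fun q => ((θ (sD q.2) * g q.1 : G) : G ⧸ N) := by
    funext q
    rw [QuotientGroup.mk_mul]
    congr 1
    conv_lhs => rw [← hsD q.2]
    rw [quotientMapOfHom_mk]
  rw [heq]
  exact hbij

end Mackey

end ContPairing

end Literature.NumberTheory.GaloisRepresentations

end
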